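import Summits.MatrixMultiplication.OmegaCensus.ThreeSetZ5Z5Cells44
import Summits.MatrixMultiplication.OmegaCensus.DominoNormCongruenceTPP
import Summits.MatrixMultiplication.OmegaCensus.DominoZ5Z5Cells
import Summits.MatrixMultiplication.OmegaCensus.DominoZ5Z5Part8
import Summits.MatrixMultiplication.OmegaCensus.DihedralLawModOneOrder25
import Summits.MatrixMultiplication.OmegaCensus.DihedralLawModOneOrder625Arith
import HarnessLib

/-!
# The `|A| ≡ 1 (mod 3)` law at `|A| = 625` over `A ↠ ℤ₅³`: no law over `ℤ₅⁴` and `ℤ₅² × ℤ₂₅` (one kernel theorem each)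

ω-census `pub-omega`, family (b3), seat pub-omega-group gen 38.  Framing: lottery ticket; floor = certified bounds/negative ranges.
VALUE: kernel theorems for the census line `|A| = 625` of the classification of dihedral-like groups attaining the law
`3|S||T||U| + 8 = 8|A|`, for the two abelian groups of order `625` with a `ℤ₅³` quotient — assembled from existing kernel cells, no new
computation; NOT progress on ω.  (For `ℤ₂₅²` and `ℤ₅ × ℤ₁₂₅` the cell `(1,13,16)` is engine-only: not covered here.)

**`no_mod_one_law_card_625_of_onto_z5_cube`**: `A` of order `625` with every element of order `< |A|/2`, `Φ : A ↠ ℤ₅²`, `φ : A ↠ ℤ₅³`.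
A law triple has cube coset parts (`two_cosets_of_mod_one_law_of_not_cube`), `(s,s | t,t | u,u)` with `stu = 208` (`cube_factor_of_625`,
`45` ordered factorisations); two parts `1` (`card_le_two_mul_addOrderOf_of_two_two_law`) or a part `2`
(`card_le_two_mul_addOrderOf_of_mod_one_law_card_four`) force an element of order `≥ |A|/2`; the remaining shapes are the census cells
`(1,4,52)` (`no_law_cube_14e_of_onto_z5z5`), `(1,8,26)` (`no_law_cube_18e_of_onto_z5z5`), `(1,13,16)` (`no_law_cube_1_13_16_of_onto_z5_cube`),
`(4,4,13)` (`no_law_cube_four_four_of_onto_z5z5_card625`) in all orderings.  Instances **`no_mod_one_law_z5_pow4`**, **`no_mod_one_law_z5_z5_z25`**.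
-/

namespace Summit.MatrixMultiplication.OmegaCensus

open Literature.Combinatorics.Additive Finset Z5Z5ThreeSet

/-! ## Assembly (generic `A` of order `625`) -/

section DihedralLike

variable {A : Type} [AddCommGroup A] [DecidableEq A] [Fintype A] {G : Type} [Group G] [DecidableEq G]
  {ρ τ : A → G} {c₀ : A} {S T U : Finset G}

/-- **No law over `A` of order `625` with small element orders, `A ↠ ℤ₅²` and `A ↠ ℤ₅³`** (any presentation constant `c₀`). [folklore] -/
theorem no_mod_one_law_card_625_of_onto_z5_cube (hA : Fintype.card A = 625) (hord : ∀ g : A, 2 * addOrderOf g < Fintype.card A)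
    (hρρ : ∀ a b, ρ a * ρ b = ρ (a + b)) (hρτ : ∀ a b, ρ a * τ b = τ (b - a))
    (hτρ : ∀ a b, τ a * ρ b = τ (a + b)) (hττ : ∀ a b, τ a * τ b = ρ (c₀ + b - a))
    (hρ : Function.Injective ρ) (hτ : Function.Injective τ) (hne : ∀ a b, ρ a ≠ τ b)
    (hsurj : ∀ g, (∃ a, ρ a = g) ∨ (∃ a, τ a = g))
    (Φ : A →+ ZMod 5 × ZMod 5) (hΦ : Function.Surjective Φ) (φ : A →+ (Fin 3 → ZMod 5)) (hφ : Function.Surjective φ)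
    (h : TripleProductProperty S T U) :
    3 * (S.card * T.card * U.card) + 8 ≠ 8 * Fintype.card A := by
  intro hV
  have big : ¬ ∃ g : A, Fintype.card A ≤ 2 * addOrderOf g := by
    rintro ⟨g, hg⟩; exact absurd (hord g) (not_lt.2 hg)
  have hmod : Fintype.card A % 3 = 1 := by rw [hA]
  have hA14 : 14 ≤ Fintype.card A := by rw [hA]; norm_num
  have hA7 : 7 ≤ Fintype.card A := by omega
  have hV_TUS : 3 * (T.card * U.card * S.card) + 8 = 8 * Fintype.card A := by
    rw [show T.card * U.card * S.card = S.card * T.card * U.card by ring]; exact hV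
  have hV_UST : 3 * (U.card * S.card * T.card) + 8 = 8 * Fintype.card A := by
    rw [show U.card * S.card * T.card = S.card * T.card * U.card by ring]; exact hV
  have hTUS : TripleProductProperty T U S := h.rotate
  have hUST : TripleProductProperty U S T := h.rotate.rotate
  by_cases hnc : ((univ.filter fun a : A => ρ a ∈ S).card = (univ.filter fun a : A => τ a ∈ S).card ∧
      (univ.filter fun a : A => ρ a ∈ T).card = (univ.filter fun a : A => τ a ∈ T).card ∧
      (univ.filter fun a : A => ρ a ∈ U).card = (univ.filter fun a : A => τ a ∈ U).card)
  · obtain ⟨hS', hT', hU'⟩ := hnc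
    have cS := card_eq_parts' hρ hτ hne hsurj S
    have cT := card_eq_parts' hρ hτ hne hsurj T
    have cU := card_eq_parts' hρ hτ hne hsurj U
    set s₀ := (univ.filter fun a : A => ρ a ∈ S).card with hs₀
    set t₀ := (univ.filter fun a : A => ρ a ∈ T).card with ht₀
    set u₀ := (univ.filter fun a : A => ρ a ∈ U).card with hu₀
    have eS : S.card = 2 * s₀ := by rw [cS, ← hS']; ring
    have eT : T.card = 2 * t₀ := by rw [cT, ← hT']; ring
    have eU : U.card = 2 * u₀ := by rw [cU, ← hU']; ring
    have hprod : 3 * (s₀ * t₀ * u₀) + 1 = 625 := by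
      rw [eS, eT, eU, hA] at hV; nlinarith
    rcases cube_factor_of_625 hprod with ⟨h1, h2, h3⟩ | ⟨h1, h2, h3⟩ | ⟨h1, h2, h3⟩ | ⟨h1, h2, h3⟩ | ⟨h1, h2, h3⟩ | ⟨h1, h2, h3⟩ | ⟨h1, h2, h3⟩ | ⟨h1, h2, h3⟩ | ⟨h1, h2, h3⟩ | ⟨h1, h2, h3⟩ | ⟨h1, h2, h3⟩ | ⟨h1, h2, h3⟩ | ⟨h1, h2, h3⟩ | ⟨h1, h2, h3⟩ | ⟨h1, h2, h3⟩ | ⟨h1, h2, h3⟩ | ⟨h1, h2, h3⟩ | ⟨h1, h2, h3⟩ | ⟨h1, h2, h3⟩ | ⟨h1, h2, h3⟩ | ⟨h1, h2, h3⟩ | ⟨h1, h2, h3⟩ | ⟨h1, h2, h3⟩ | ⟨h1, h2, h3⟩ | ⟨h1, h2, h3⟩ | ⟨h1, h2, h3⟩ | ⟨h1, h2, h3⟩ | ⟨h1, h2, h3⟩ | ⟨h1, h2, h3⟩ | ⟨h1, h2, h3⟩ | ⟨h1, h2, h3⟩ | ⟨h1, h2, h3⟩ | ⟨h1, h2, h3⟩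 | ⟨h1, h2, h3⟩ | ⟨h1, h2, h3⟩ | ⟨h1, h2, h3⟩ | ⟨h1, h2, h3⟩ | ⟨h1, h2, h3⟩ | ⟨h1, h2, h3⟩ | ⟨h1, h2, h3⟩ | ⟨h1, h2, h3⟩ | ⟨h1, h2, h3⟩ | ⟨h1, h2, h3⟩ | ⟨h1, h2, h3⟩ | ⟨h1, h2, h3⟩
    · -- (1,1,208)
      exact big (card_le_two_mul_addOrderOf_of_two_two_law hρρ hρτ hτρ hττ hρ hτ hne hsurj hmod hA7 h (by rw [eS, h1]) (by rw [eT, h2]) hV)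
    · -- (1,2,104)
      exact big (card_le_two_mul_addOrderOf_of_mod_one_law_card_four hρρ hρτ hτρ hττ hρ hτ hne hsurj hmod hA14 h hV (by rw [eT, h2]))
    · -- (1,4,52)
      exact absurd hV (no_law_cube_two_parts_of_ordered 1 4 (fun h' hS₀ hS₁ hT₀ hT₁ hU'' hV'' => no_law_cube_14e_of_onto_z5z5 hρρ hρτ hτρ hττ hρ hτ hne hsurj Φ hΦ h' hS₀ hS₁ hT₀ hT₁ hU'' hV'') h hS' hT' hU'
        (Or.inl ⟨h1, h2⟩))
    · -- (1,8,26)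
      exact absurd hV (no_law_cube_two_parts_of_ordered 1 8 (fun h' hS₀ hS₁ hT₀ hT₁ hU'' hV'' => no_law_cube_18e_of_onto_z5z5 hρρ hρτ hτρ hττ hρ hτ hne hsurj Φ hΦ h' hS₀ hS₁ hT₀ hT₁ hU'' hV'') h hS' hT' hU'
        (Or.inl ⟨h1, h2⟩))
    · -- (1,13,16)
      exact absurd hV (no_law_cube_two_parts_of_ordered 1 13 (fun h' hS₀ hS₁ hT₀ hT₁ hU'' hV'' => no_law_cube_1_13_16_of_onto_z5_cube hρρ hρτ hτρ hττ hρ hτ hne hsurj φ hφ h' hS₀ hS₁ hT₀ hT₁ hU'' hV'') h hS' hT' hU'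
        (Or.inl ⟨h1, h2⟩))
    · -- (1,16,13)
      exact absurd hV (no_law_cube_two_parts_of_ordered 1 13 (fun h' hS₀ hS₁ hT₀ hT₁ hU'' hV'' => no_law_cube_1_13_16_of_onto_z5_cube hρρ hρτ hτρ hττ hρ hτ hne hsurj φ hφ h' hS₀ hS₁ hT₀ hT₁ hU'' hV'') h hS' hT' hU'
        (Or.inr (Or.inr (Or.inr (Or.inr (Or.inr (⟨h3, h1⟩)))))))
    · -- (1,26,8)
      exact absurd hV (no_law_cube_two_parts_of_ordered 1 8 (fun h' hS₀ hS₁ hT₀ hT₁ hU'' hV'' => no_law_cube_18e_of_onto_z5z5 hρρ hρτ hτρ hττ hρ hτ hne hsurj Φ hΦ h' hS₀ hS₁ hT₀ hT₁ hU'' hV'') h hS' hT' hU'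
        (Or.inr (Or.inr (Or.inr (Or.inr (Or.inr (⟨h3, h1⟩)))))))
    · -- (1,52,4)
      exact absurd hV (no_law_cube_two_parts_of_ordered 1 4 (fun h' hS₀ hS₁ hT₀ hT₁ hU'' hV'' => no_law_cube_14e_of_onto_z5z5 hρρ hρτ hτρ hττ hρ hτ hne hsurj Φ hΦ h' hS₀ hS₁ hT₀ hT₁ hU'' hV'') h hS' hT' hU'
        (Or.inr (Or.inr (Or.inr (Or.inr (Or.inr (⟨h3, h1⟩)))))))
    · -- (1,104,2)
      exact big (card_le_two_mul_addOrderOf_of_mod_one_law_card_four hρρ hρτ hτρ hττ hρ hτ hne hsurj hmod hA14 hTUS hV_TUS (by rw [eU, h3]))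
    · -- (1,208,1)
      exact big (card_le_two_mul_addOrderOf_of_two_two_law hρρ hρτ hτρ hττ hρ hτ hne hsurj hmod hA7 hUST (by rw [eU, h3]) (by rw [eS, h1]) hV_UST)
    · -- (2,1,104)
      exact big (card_le_two_mul_addOrderOf_of_mod_one_law_card_four hρρ hρτ hτρ hττ hρ hτ hne hsurj hmod hA14 hUST hV_UST (by rw [eS, h1]))
    · -- (2,2,52)
      exact big (card_le_two_mul_addOrderOf_of_mod_one_law_card_four hρρ hρτ hτρ hττ hρ hτ hne hsurj hmod hA14 h hV (by rw [eT, h2]))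
    · -- (2,4,26)
      exact big (card_le_two_mul_addOrderOf_of_mod_one_law_card_four hρρ hρτ hτρ hττ hρ hτ hne hsurj hmod hA14 hUST hV_UST (by rw [eS, h1]))
    · -- (2,8,13)
      exact big (card_le_two_mul_addOrderOf_of_mod_one_law_card_four hρρ hρτ hτρ hττ hρ hτ hne hsurj hmod hA14 hUST hV_UST (by rw [eS, h1]))
    · -- (2,13,8)
      exact big (card_le_two_mul_addOrderOf_of_mod_one_law_card_four hρρ hρτ hτρ hττ hρ hτ hne hsurj hmod hA14 hUST hV_UST (by rw [eS, h1]))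
    · -- (2,26,4)
      exact big (card_le_two_mul_addOrderOf_of_mod_one_law_card_four hρρ hρτ hτρ hττ hρ hτ hne hsurj hmod hA14 hUST hV_UST (by rw [eS, h1]))
    · -- (2,52,2)
      exact big (card_le_two_mul_addOrderOf_of_mod_one_law_card_four hρρ hρτ hτρ hττ hρ hτ hne hsurj hmod hA14 hUST hV_UST (by rw [eS, h1]))
    · -- (2,104,1)
      exact big (card_le_two_mul_addOrderOf_of_mod_one_law_card_four hρρ hρτ hτρ hττ hρ hτ hne hsurj hmod hA14 hUST hV_UST (by rw [eS, h1]))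
    · -- (4,1,52)
      exact absurd hV (no_law_cube_two_parts_of_ordered 1 4 (fun h' hS₀ hS₁ hT₀ hT₁ hU'' hV'' => no_law_cube_14e_of_onto_z5z5 hρρ hρτ hτρ hττ hρ hτ hne hsurj Φ hΦ h' hS₀ hS₁ hT₀ hT₁ hU'' hV'') h hS' hT' hU'
        (Or.inr (Or.inr (Or.inr (Or.inl ⟨h1, h2⟩)))))
    · -- (4,2,26)
      exact big (card_le_two_mul_addOrderOf_of_mod_one_law_card_four hρρ hρτ hτρ hττ hρ hτ hne hsurj hmod hA14 h hV (by rw [eT, h2]))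
    · -- (4,4,13)
      exact absurd hV (no_law_cube_four_four_of_onto_z5z5_card625 hA hρρ hρτ hτρ hττ hρ hτ hne hsurj Φ hΦ h hS' hT' hU' (Or.inl ⟨h1, h2⟩))
    · -- (4,13,4)
      exact absurd hV (no_law_cube_four_four_of_onto_z5z5_card625 hA hρρ hρτ hτρ hττ hρ hτ hne hsurj Φ hΦ h hS' hT' hU' (Or.inr (Or.inr (Or.inl ⟨h3, h1⟩))))
    · -- (4,26,2)
      exact big (card_le_two_mul_addOrderOf_of_mod_one_law_card_four hρρ hρτ hτρ hττ hρ hτ hne hsurj hmod hA14 hTUS hV_TUS (by rw [eU, h3]))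
    · -- (4,52,1)
      exact absurd hV (no_law_cube_two_parts_of_ordered 1 4 (fun h' hS₀ hS₁ hT₀ hT₁ hU'' hV'' => no_law_cube_14e_of_onto_z5z5 hρρ hρτ hτρ hττ hρ hτ hne hsurj Φ hΦ h' hS₀ hS₁ hT₀ hT₁ hU'' hV'') h hS' hT' hU'
        (Or.inr (Or.inr (Or.inl ⟨h3, h1⟩))))
    · -- (8,1,26)
      exact absurd hV (no_law_cube_two_parts_of_ordered 1 8 (fun h' hS₀ hS₁ hT₀ hT₁ hU'' hV'' => no_law_cube_18e_of_onto_z5z5 hρρ hρτ hτρ hττ hρ hτ hne hsurj Φ hΦ h' hS₀ hS₁ hT₀ hT₁ hU'' hV'') h hS' hT' hU'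
        (Or.inr (Or.inr (Or.inr (Or.inl ⟨h1, h2⟩)))))
    · -- (8,2,13)
      exact big (card_le_two_mul_addOrderOf_of_mod_one_law_card_four hρρ hρτ hτρ hττ hρ hτ hne hsurj hmod hA14 h hV (by rw [eT, h2]))
    · -- (8,13,2)
      exact big (card_le_two_mul_addOrderOf_of_mod_one_law_card_four hρρ hρτ hτρ hττ hρ hτ hne hsurj hmod hA14 hTUS hV_TUS (by rw [eU, h3]))
    · -- (8,26,1)
      exact absurd hV (no_law_cube_two_parts_of_ordered 1 8 (fun h' hS₀ hS₁ hT₀ hT₁ hU'' hV'' => no_law_cube_18e_of_onto_z5z5 hρρ hρτ hτρ hττ hρ hτ hne hsurj Φ hΦ h' hS₀ hS₁ hT₀ hT₁ hU'' hV'') h hS' hT' hU'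
        (Or.inr (Or.inr (Or.inl ⟨h3, h1⟩))))
    · -- (13,1,16)
      exact absurd hV (no_law_cube_two_parts_of_ordered 1 13 (fun h' hS₀ hS₁ hT₀ hT₁ hU'' hV'' => no_law_cube_1_13_16_of_onto_z5_cube hρρ hρτ hτρ hττ hρ hτ hne hsurj φ hφ h' hS₀ hS₁ hT₀ hT₁ hU'' hV'') h hS' hT' hU'
        (Or.inr (Or.inr (Or.inr (Or.inl ⟨h1, h2⟩)))))
    · -- (13,2,8)
      exact big (card_le_two_mul_addOrderOf_of_mod_one_law_card_four hρρ hρτ hτρ hττ hρ hτ hne hsurj hmod hA14 h hV (by rw [eT, h2]))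
    · -- (13,4,4)
      exact absurd hV (no_law_cube_four_four_of_onto_z5z5_card625 hA hρρ hρτ hτρ hττ hρ hτ hne hsurj Φ hΦ h hS' hT' hU' (Or.inr (Or.inl ⟨h2, h3⟩)))
    · -- (13,8,2)
      exact big (card_le_two_mul_addOrderOf_of_mod_one_law_card_four hρρ hρτ hτρ hττ hρ hτ hne hsurj hmod hA14 hTUS hV_TUS (by rw [eU, h3]))
    · -- (13,16,1)
      exact absurd hV (no_law_cube_two_parts_of_ordered 1 13 (fun h' hS₀ hS₁ hT₀ hT₁ hU'' hV'' => no_law_cube_1_13_16_of_onto_z5_cube hρρ hρτ hτρ hττ hρ hτ hne hsurj φ hφ h' hS₀ hS₁ hT₀ hT₁ hU'' hV'') h hS' hT' hU'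
        (Or.inr (Or.inr (Or.inl ⟨h3, h1⟩))))
    · -- (16,1,13)
      exact absurd hV (no_law_cube_two_parts_of_ordered 1 13 (fun h' hS₀ hS₁ hT₀ hT₁ hU'' hV'' => no_law_cube_1_13_16_of_onto_z5_cube hρρ hρτ hτρ hττ hρ hτ hne hsurj φ hφ h' hS₀ hS₁ hT₀ hT₁ hU'' hV'') h hS' hT' hU'
        (Or.inr (Or.inl ⟨h2, h3⟩)))
    · -- (16,13,1)
      exact absurd hV (no_law_cube_two_parts_of_ordered 1 13 (fun h' hS₀ hS₁ hT₀ hT₁ hU'' hV'' => no_law_cube_1_13_16_of_onto_z5_cube hρρ hρτ hτρ hττ hρ hτ hne hsurj φ hφ h' hS₀ hS₁ hT₀ hT₁ hU'' hV'') h hS' hT' hU'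
        (Or.inr (Or.inr (Or.inr (Or.inr (Or.inl ⟨h2, h3⟩))))))
    · -- (26,1,8)
      exact absurd hV (no_law_cube_two_parts_of_ordered 1 8 (fun h' hS₀ hS₁ hT₀ hT₁ hU'' hV'' => no_law_cube_18e_of_onto_z5z5 hρρ hρτ hτρ hττ hρ hτ hne hsurj Φ hΦ h' hS₀ hS₁ hT₀ hT₁ hU'' hV'') h hS' hT' hU'
        (Or.inr (Or.inl ⟨h2, h3⟩)))
    · -- (26,2,4)
      exact big (card_le_two_mul_addOrderOf_of_mod_one_law_card_four hρρ hρτ hτρ hττ hρ hτ hne hsurj hmod hA14 h hV (by rw [eT, h2]))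
    · -- (26,4,2)
      exact big (card_le_two_mul_addOrderOf_of_mod_one_law_card_four hρρ hρτ hτρ hττ hρ hτ hne hsurj hmod hA14 hTUS hV_TUS (by rw [eU, h3]))
    · -- (26,8,1)
      exact absurd hV (no_law_cube_two_parts_of_ordered 1 8 (fun h' hS₀ hS₁ hT₀ hT₁ hU'' hV'' => no_law_cube_18e_of_onto_z5z5 hρρ hρτ hτρ hττ hρ hτ hne hsurj Φ hΦ h' hS₀ hS₁ hT₀ hT₁ hU'' hV'') h hS' hT' hU'
        (Or.inr (Or.inr (Or.inr (Or.inr (Or.inl ⟨h2, h3⟩))))))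
    · -- (52,1,4)
      exact absurd hV (no_law_cube_two_parts_of_ordered 1 4 (fun h' hS₀ hS₁ hT₀ hT₁ hU'' hV'' => no_law_cube_14e_of_onto_z5z5 hρρ hρτ hτρ hττ hρ hτ hne hsurj Φ hΦ h' hS₀ hS₁ hT₀ hT₁ hU'' hV'') h hS' hT' hU'
        (Or.inr (Or.inl ⟨h2, h3⟩)))
    · -- (52,2,2)
      exact big (card_le_two_mul_addOrderOf_of_mod_one_law_card_four hρρ hρτ hτρ hττ hρ hτ hne hsurj hmod hA14 h hV (by rw [eT, h2]))
    · -- (52,4,1)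
      exact absurd hV (no_law_cube_two_parts_of_ordered 1 4 (fun h' hS₀ hS₁ hT₀ hT₁ hU'' hV'' => no_law_cube_14e_of_onto_z5z5 hρρ hρτ hτρ hττ hρ hτ hne hsurj Φ hΦ h' hS₀ hS₁ hT₀ hT₁ hU'' hV'') h hS' hT' hU'
        (Or.inr (Or.inr (Or.inr (Or.inr (Or.inl ⟨h2, h3⟩))))))
    · -- (104,1,2)
      exact big (card_le_two_mul_addOrderOf_of_mod_one_law_card_four hρρ hρτ hτρ hττ hρ hτ hne hsurj hmod hA14 hTUS hV_TUS (by rw [eU, h3]))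
    · -- (104,2,1)
      exact big (card_le_two_mul_addOrderOf_of_mod_one_law_card_four hρρ hρτ hτρ hττ hρ hτ hne hsurj hmod hA14 h hV (by rw [eT, h2]))
    · -- (208,1,1)
      exact big (card_le_two_mul_addOrderOf_of_two_two_law hρρ hρτ hτρ hττ hρ hτ hne hsurj hmod hA7 hTUS (by rw [eT, h2]) (by rw [eU, h3]) hV_TUS)
  · obtain ⟨g, a, b, hab⟩ :=
      two_cosets_of_mod_one_law_of_not_cube hρρ hρτ hτρ hττ hρ hτ hne hsurj hmod hA14 h hV hnc
    exact big ⟨g, card_le_two_mul_addOrderOf_of_two_cosets hab⟩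

end DihedralLike

/-! ## Instances: `ℤ₅⁴` and `ℤ₅² × ℤ₂₅` -/

section Instances

variable {G : Type} [Group G] [DecidableEq G] {S T U : Finset G}

/-- The projection `ℤ₅⁴ ↠ ℤ₅³` onto the first three coordinates. [folklore] -/
def Z5Z5ThreeSet.projZ5CubeOfPow4 : ZMod 5 × ZMod 5 × ZMod 5 × ZMod 5 →+ (Fin 3 → ZMod 5) where
  toFun a := ![a.1, a.2.1, a.2.2.1]
  map_zero' := by ext i; fin_cases i <;> rfl
  map_add' a b := by ext i; fin_cases i <;> rfl

/-- `projZ5CubeOfPow4` is onto. [folklore] -/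
theorem Z5Z5ThreeSet.projZ5CubeOfPow4_surjective : Function.Surjective projZ5CubeOfPow4 :=
  fun v => ⟨(v 0, v 1, v 2, 0), by ext i; fin_cases i <;> rfl⟩

/-- The projection `ℤ₅ × ℤ₅ × ℤ₂₅ ↠ ℤ₅³` (reduction mod `5` in the last coordinate). [folklore] -/
def Z5Z5ThreeSet.projZ5CubeOfZ5Z5Z25 : ZMod 5 × ZMod 5 × ZMod 25 →+ (Fin 3 → ZMod 5) where
  toFun a := ![a.1, a.2.1, ZMod.castHom (show 5 ∣ 25 by norm_num) (ZMod 5) a.2.2]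
  map_zero' := by ext i; fin_cases i <;> simp
  map_add' a b := by ext i; fin_cases i <;> simp

/-- `projZ5CubeOfZ5Z5Z25` is onto. [folklore] -/
theorem Z5Z5ThreeSet.projZ5CubeOfZ5Z5Z25_surjective : Function.Surjective projZ5CubeOfZ5Z5Z25 := by
  intro v
  obtain ⟨c, hc⟩ := ZMod.castHom_surjective (show 5 ∣ 25 by norm_num) (n := 25) (v 2)
  refine ⟨(v 0, v 1, c), ?_⟩
  ext i; fin_cases i
  · rfl
  · rfl
  · exact hc

/-- Every element of `ℤ₅⁴` has order `≤ 5`. [folklore] -/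
theorem Z5Z5ThreeSet.two_mul_addOrderOf_lt_z5_pow4 (g : ZMod 5 × ZMod 5 × ZMod 5 × ZMod 5) :
    2 * addOrderOf g < Fintype.card (ZMod 5 × ZMod 5 × ZMod 5 × ZMod 5) := by
  have h5 : 5 • g = 0 := by
    have e : ((5 : ℕ) : ZMod 5) = 0 := by decide
    refine Prod.ext ?_ (Prod.ext ?_ (Prod.ext ?_ ?_))
    · show 5 • g.1 = 0
      rw [nsmul_eq_mul, e, zero_mul]
    · show 5 • g.2.1 = 0
      rw [nsmul_eq_mul, e, zero_mul]
    · show 5 • g.2.2.1 = 0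
      rw [nsmul_eq_mul, e, zero_mul]
    · show 5 • g.2.2.2 = 0
      rw [nsmul_eq_mul, e, zero_mul]
  have hle : addOrderOf g ≤ 5 := Nat.le_of_dvd (by norm_num) (addOrderOf_dvd_of_nsmul_eq_zero h5)
  have hA : Fintype.card (ZMod 5 × ZMod 5 × ZMod 5 × ZMod 5) = 625 := by simp [Fintype.card_prod, ZMod.card]
  omega

/-- Every element of `ℤ₅ × ℤ₅ × ℤ₂₅` has order `≤ 25`. [folklore] -/
theorem Z5Z5ThreeSet.two_mul_addOrderOf_lt_z5_z5_z25 (g : ZMod 5 × ZMod 5 × ZMod 25) :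
    2 * addOrderOf g < Fintype.card (ZMod 5 × ZMod 5 × ZMod 25) := by
  have h25 : 25 • g = 0 := by
    refine Prod.ext ?_ (Prod.ext ?_ ?_)
    · show 25 • g.1 = 0
      rw [nsmul_eq_mul, show ((25 : ℕ) : ZMod 5) = 0 from by decide, zero_mul]
    · show 25 • g.2.1 = 0
      rw [nsmul_eq_mul, show ((25 : ℕ) : ZMod 5) = 0 from by decide, zero_mul]
    · show 25 • g.2.2 = 0
      rw [nsmul_eq_mul, show ((25 : ℕ) : ZMod 25) = 0 from by decide, zero_mul]
  have hle : addOrderOf g ≤ 25 := Nat.le_of_dvd (by norm_num) (addOrderOf_dvd_of_nsmul_eq_zero h25)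
  have hA : Fintype.card (ZMod 5 × ZMod 5 × ZMod 25) = 625 := by simp [Fintype.card_prod, ZMod.card]
  omega

/-- **ORDER 625, `A = ℤ₅⁴`**: no dihedral-like group over it (any `c₀`) has a TPP triple attaining `3|S||T||U| + 8 = 8|A|`. [folklore] -/
theorem no_mod_one_law_z5_pow4 {ρ τ : ZMod 5 × ZMod 5 × ZMod 5 × ZMod 5 → G} {c₀ : ZMod 5 × ZMod 5 × ZMod 5 × ZMod 5}
    (hρρ : ∀ a b, ρ a * ρ b = ρ (a + b)) (hρτ : ∀ a b, ρ a * τ b = τ (b - a))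
    (hτρ : ∀ a b, τ a * ρ b = τ (a + b)) (hττ : ∀ a b, τ a * τ b = ρ (c₀ + b - a))
    (hρ : Function.Injective ρ) (hτ : Function.Injective τ) (hne : ∀ a b, ρ a ≠ τ b)
    (hsurj : ∀ g, (∃ a, ρ a = g) ∨ (∃ a, τ a = g)) (h : TripleProductProperty S T U) :
    3 * (S.card * T.card * U.card) + 8 ≠ 8 * Fintype.card (ZMod 5 × ZMod 5 × ZMod 5 × ZMod 5) :=
  no_mod_one_law_card_625_of_onto_z5_cube (by simp [Fintype.card_prod, ZMod.card]) two_mul_addOrderOf_lt_z5_pow4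
    hρρ hρτ hτρ hττ hρ hτ hne hsurj projZ5Pow4 projZ5Pow4_surjective projZ5CubeOfPow4 projZ5CubeOfPow4_surjective h

/-- **ORDER 625, `A = ℤ₅ × ℤ₅ × ℤ₂₅`**: no dihedral-like group over it (any `c₀`) has a TPP triple attaining `3|S||T||U| + 8 = 8|A|`.
[folklore] -/
theorem no_mod_one_law_z5_z5_z25 {ρ τ : ZMod 5 × ZMod 5 × ZMod 25 → G} {c₀ : ZMod 5 × ZMod 5 × ZMod 25}
    (hρρ : ∀ a b, ρ a * ρ b = ρ (a + b)) (hρτ : ∀ a b, ρ a * τ b = τ (b - a))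
    (hτρ : ∀ a b, τ a * ρ b = τ (a + b)) (hττ : ∀ a b, τ a * τ b = ρ (c₀ + b - a))
    (hρ : Function.Injective ρ) (hτ : Function.Injective τ) (hne : ∀ a b, ρ a ≠ τ b)
    (hsurj : ∀ g, (∃ a, ρ a = g) ∨ (∃ a, τ a = g)) (h : TripleProductProperty S T U) :
    3 * (S.card * T.card * U.card) + 8 ≠ 8 * Fintype.card (ZMod 5 × ZMod 5 × ZMod 25) :=
  no_mod_one_law_card_625_of_onto_z5_cube (by simp [Fintype.card_prod, ZMod.card]) two_mul_addOrderOf_lt_z5_z5_z25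
    hρρ hρτ hτρ hττ hρ hτ hne hsurj projZ5Z5Z25 projZ5Z5Z25_surjective projZ5CubeOfZ5Z5Z25 projZ5CubeOfZ5Z5Z25_surjective h

end Instances

end Summit.MatrixMultiplication.OmegaCensus
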